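import Mathlib
import Summits.ValiantsHypothesis.ValiantsHypothesis.Theorems.NewtonUnitEquationsTwoProductsSeparated

/-! # Rung `stub_engineTwoRayAxial` — crux `TwoProducts` (stmt-ValiantsHypothesis-5906), line `corner-log-linearization`

TWO-RAY SEPARATED FACTORS (lead c7; t-free).  Let `ν₁, ν₂ ∈ ℕ²` be linearly independent exponents and let every factor be the image,
under the monomial substitution `X ↦ x^{ν₁}`, `Y ↦ x^{ν₂}`, of a SEPARATED factor `f_i(X) + g_i(Y)` (`f_i` supported on the `X`-axis,
`g_i` on the `Y`-axis) — e.g. factors all of whose monomials lie on the two rays `ℕν₁ ∪ ℕν₂`, arbitrarily many on each.  Then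
`∏ u − ∏ v` has at most `2^{n+1}` south-west vertices: the substitution is the injective additive exponent map `θ(q) = q₀ν₁ + q₁ν₂`,
which carries supports bijectively and pulls a positive weight `w` back to the positive weight `(w·ν₁, w·ν₂)`, so south-west vertices
pull back to south-west vertices of the separated instance, counted by the landed Separated rung (p133405). [folklore] -/

set_option linter.dupNamespace false -- single-conjunct summit: `ValiantsHypothesis.ValiantsHypothesis`

namespace Summit.ValiantsHypothesis.ValiantsHypothesis.Theorems.TwoProducts.TwoRayAxial

open scoped BigOperators
open MvPolynomial

/-- The exponent map of the two-ray substitution. [folklore] -/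
theorem theta_apply (ν₁ ν₂ : Fin 2 →₀ ℕ) (q : Fin 2 →₀ ℕ) (i : Fin 2) :
    (q 0 • ν₁ + q 1 • ν₂) i = q 0 * ν₁ i + q 1 * ν₂ i := by
  simp [Finsupp.add_apply, Finsupp.smul_apply]

/-- The exponent map is injective for independent rays. [folklore] -/
theorem theta_injective (ν₁ ν₂ : Fin 2 →₀ ℕ) (hind : ν₁ 0 * ν₂ 1 ≠ ν₁ 1 * ν₂ 0) :
    Function.Injective (fun q : Fin 2 →₀ ℕ => q 0 • ν₁ + q 1 • ν₂) := by
  intro q q' h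
  have h0 := congrArg (fun f : Fin 2 →₀ ℕ => (f 0 : ℤ)) h
  have h1 := congrArg (fun f : Fin 2 →₀ ℕ => (f 1 : ℤ)) h
  simp only [theta_apply, Nat.cast_add, Nat.cast_mul] at h0 h1
  have hdet : ((ν₁ 0 : ℤ) * ν₂ 1 - ν₁ 1 * ν₂ 0) ≠ 0 := by
    intro hz; apply hind; exact_mod_cast (sub_eq_zero.mp hz)
  have hq0 : ((q 0 : ℕ) : ℤ) = q' 0 := by
    have := mul_left_cancel₀ hdet (a := ((ν₁ 0 : ℤ) * ν₂ 1 - ν₁ 1 * ν₂ 0)) (b := (q 0 : ℤ)) (c := (q' 0 : ℤ))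
      (by linear_combination (ν₂ 1 : ℤ) * h0 - (ν₂ 0 : ℤ) * h1)
    exact this
  have hq1 : ((q 1 : ℕ) : ℤ) = q' 1 := by
    have := mul_left_cancel₀ hdet (a := ((ν₁ 0 : ℤ) * ν₂ 1 - ν₁ 1 * ν₂ 0)) (b := (q 1 : ℤ)) (c := (q' 1 : ℤ))
      (by linear_combination (ν₁ 0 : ℤ) * h1 - (ν₁ 1 : ℤ) * h0)
    exact this
  ext i; fin_cases i
  · exact_mod_cast hq0
  · exact_mod_cast hq1

/-- The substitution on a monomial. [folklore] -/
theorem aeval_monomial_two (ν₁ ν₂ : Fin 2 →₀ ℕ) (ε : Fin 2 →₀ ℕ) (c : ℂ) :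
    MvPolynomial.aeval (fun j : Fin 2 => if j = 0 then monomial ν₁ (1 : ℂ) else monomial ν₂ 1) (monomial ε c) =
      monomial (ε 0 • ν₁ + ε 1 • ν₂) c := by
  rw [aeval_monomial, Finsupp.prod_fintype _ _ (fun i => by simp), Fin.prod_univ_two]
  simp only [Fin.isValue, ↓reduceIte, one_ne_zero, monomial_pow, one_pow, monomial_mul, mul_one, algebraMap_eq]
  rw [C_mul_monomial, mul_one]

/-- The substitution expands coefficientwise over the support. [folklore] -/
theorem aeval_eq_sum (ν₁ ν₂ : Fin 2 →₀ ℕ) (p : MvPolynomial (Fin 2) ℂ) :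
    MvPolynomial.aeval (fun j : Fin 2 => if j = 0 then monomial ν₁ (1 : ℂ) else monomial ν₂ 1) p =
      ∑ ε ∈ p.support, monomial (ε 0 • ν₁ + ε 1 • ν₂) (coeff ε p) := by
  conv_lhs => rw [p.as_sum]
  rw [map_sum]
  exact Finset.sum_congr rfl fun ε _ => aeval_monomial_two ν₁ ν₂ ε _

/-- Coefficients are carried along the exponent map. [folklore] -/
theorem coeff_aeval_theta (ν₁ ν₂ : Fin 2 →₀ ℕ) (hind : ν₁ 0 * ν₂ 1 ≠ ν₁ 1 * ν₂ 0) (p : MvPolynomial (Fin 2) ℂ)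
    (ε : Fin 2 →₀ ℕ) :
    coeff (ε 0 • ν₁ + ε 1 • ν₂)
      (MvPolynomial.aeval (fun j : Fin 2 => if j = 0 then monomial ν₁ (1 : ℂ) else monomial ν₂ 1) p) = coeff ε p := by
  classical
  rw [aeval_eq_sum, coeff_sum]
  by_cases hε : ε ∈ p.support
  · rw [Finset.sum_eq_single ε]
    · rw [coeff_monomial, if_pos rfl]
    · intro ε' _ hne
      rw [coeff_monomial, if_neg]
      exact fun h => hne (theta_injective ν₁ ν₂ hind h)
    · intro h; exact absurd hε h
  · rw [Finset.sum_eq_zero]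
    · exact (notMem_support_iff.mp hε).symm
    · intro ε' hε'
      rw [coeff_monomial, if_neg]
      exact fun h => hε (theta_injective ν₁ ν₂ hind h ▸ hε')

/-- Every support point of the substituted polynomial is the image of a support point. [folklore] -/
theorem exists_of_mem_support_aeval (ν₁ ν₂ : Fin 2 →₀ ℕ) (p : MvPolynomial (Fin 2) ℂ) {e : Fin 2 →₀ ℕ}
    (he : e ∈ (MvPolynomial.aeval (fun j : Fin 2 => if j = 0 then monomial ν₁ (1 : ℂ) else monomial ν₂ 1) p).support) :
    ∃ ε ∈ p.support, e = ε 0 • ν₁ + ε 1 • ν₂ := by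
  classical
  rw [aeval_eq_sum] at he
  obtain ⟨ε, hε, hmem⟩ := Finset.mem_biUnion.mp (support_sum he)
  exact ⟨ε, hε, Finset.mem_singleton.mp (support_monomial_subset hmem)⟩

/-- Weights pull back along the exponent map: `w·θ(q) = (w·ν₁) q₀ + (w·ν₂) q₁`. [folklore] -/
theorem wt_theta (ν₁ ν₂ : Fin 2 →₀ ℕ) (w : Fin 2 → ℤ) (q : Fin 2 →₀ ℕ) :
    w 0 * ((q 0 • ν₁ + q 1 • ν₂ : Fin 2 →₀ ℕ) 0 : ℤ) + w 1 * ((q 0 • ν₁ + q 1 • ν₂ : Fin 2 →₀ ℕ) 1 : ℤ) =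
      (w 0 * (ν₁ 0 : ℤ) + w 1 * (ν₁ 1 : ℤ)) * (q 0 : ℤ) + (w 0 * (ν₂ 0 : ℤ) + w 1 * (ν₂ 1 : ℤ)) * (q 1 : ℤ) := by
  simp only [theta_apply, Nat.cast_add, Nat.cast_mul]
  ring

/-- A nonzero exponent has positive weight for a positive weight vector. [folklore] -/
theorem wt_pos (w : Fin 2 → ℤ) (hw0 : 0 < w 0) (hw1 : 0 < w 1) (ν : Fin 2 →₀ ℕ) (hν : ν ≠ 0) :
    0 < w 0 * (ν 0 : ℤ) + w 1 * (ν 1 : ℤ) := by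
  have h : ν 0 ≠ 0 ∨ ν 1 ≠ 0 := by
    by_contra hcon
    push Not at hcon
    exact hν (by ext i; fin_cases i <;> simp [hcon.1, hcon.2])
  rcases h with h | h
  · have h1 : (1 : ℤ) ≤ (ν 0 : ℤ) := by exact_mod_cast Nat.one_le_iff_ne_zero.mpr h
    have h2 : (0 : ℤ) ≤ (ν 1 : ℤ) := by positivity
    nlinarith
  · have h1 : (1 : ℤ) ≤ (ν 1 : ℤ) := by exact_mod_cast Nat.one_le_iff_ne_zero.mpr h
    have h2 : (0 : ℤ) ≤ (ν 0 : ℤ) := by positivity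
    nlinarith

/-- **RUNG `stub_engineTwoRayAxial`** (registered signature). [folklore] -/
theorem stub_engineTwoRayAxial : ∀ (n : ℕ) (ν₁ ν₂ : Fin 2 →₀ ℕ) (f g f' g' : Fin n → MvPolynomial (Fin 2) ℂ),
    ν₁ 0 * ν₂ 1 ≠ ν₁ 1 * ν₂ 0 →
    (∀ i, ∀ q ∈ (f i).support, q 1 = 0) → (∀ i, ∀ q ∈ (g i).support, q 0 = 0) →
    (∀ i, ∀ q ∈ (f' i).support, q 1 = 0) → (∀ i, ∀ q ∈ (g' i).support, q 0 = 0) →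
    {e : Fin 2 →₀ ℕ | ∃ w : Fin 2 → ℤ, 0 < w 0 ∧ 0 < w 1 ∧
        e ∈ ((∏ i, MvPolynomial.aeval (fun j : Fin 2 => if j = 0 then MvPolynomial.monomial ν₁ (1 : ℂ)
                else MvPolynomial.monomial ν₂ 1) (f i + g i)) -
              ∏ i, MvPolynomial.aeval (fun j : Fin 2 => if j = 0 then MvPolynomial.monomial ν₁ (1 : ℂ)
                else MvPolynomial.monomial ν₂ 1) (f' i + g' i)).support ∧
        ∀ e' ∈ ((∏ i, MvPolynomial.aeval (fun j : Fin 2 => if j = 0 then MvPolynomial.monomial ν₁ (1 : ℂ)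
                else MvPolynomial.monomial ν₂ 1) (f i + g i)) -
              ∏ i, MvPolynomial.aeval (fun j : Fin 2 => if j = 0 then MvPolynomial.monomial ν₁ (1 : ℂ)
                else MvPolynomial.monomial ν₂ 1) (f' i + g' i)).support, e' ≠ e →
          w 0 * (e 0 : ℤ) + w 1 * (e 1 : ℤ) < w 0 * (e' 0 : ℤ) + w 1 * (e' 1 : ℤ)}.ncard ≤ 2 ^ (n + 1) := by
  classical
  intro n ν₁ ν₂ f g f' g' hind hf hg hf' hg'
  set Φ := MvPolynomial.aeval (R := ℂ) (fun j : Fin 2 => if j = 0 then monomial ν₁ (1 : ℂ) else monomial ν₂ 1) with hΦ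
  set Dt : MvPolynomial (Fin 2) ℂ := (∏ i, (f i + 1 * g i)) - ∏ i, (f' i + 1 * g' i) with hDt
  have hD : ((∏ i, Φ (f i + g i)) - ∏ i, Φ (f' i + g' i)) = Φ Dt := by
    simp only [hDt, map_sub, map_prod, one_mul]
  -- independence forces both rays to be nonzero
  have hν₁ : ν₁ ≠ 0 := by rintro rfl; simp at hind
  have hν₂ : ν₂ ≠ 0 := by rintro rfl; simp at hind
  -- the separated count for `Dt`
  have hsep := Separated.stub_engineSeparated n f (fun _ => 1) f' (fun _ => 1) g g' hf
    (fun i q hq => by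
      rw [support_one] at hq
      rw [Finset.mem_singleton.mp hq]; rfl)
    hf' (fun i q hq => by
      rw [support_one] at hq
      rw [Finset.mem_singleton.mp hq]; rfl) hg hg'
  -- vertices pull back along `θ`
  set θ : (Fin 2 →₀ ℕ) → (Fin 2 →₀ ℕ) := fun q => q 0 • ν₁ + q 1 • ν₂ with hθ
  have hsub : {e : Fin 2 →₀ ℕ | ∃ w : Fin 2 → ℤ, 0 < w 0 ∧ 0 < w 1 ∧ e ∈ (Φ Dt).support ∧
        ∀ e' ∈ (Φ Dt).support, e' ≠ e → w 0 * (e 0 : ℤ) + w 1 * (e 1 : ℤ) < w 0 * (e' 0 : ℤ) + w 1 * (e' 1 : ℤ)} ⊆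
      θ '' {ε : Fin 2 →₀ ℕ | ∃ w : Fin 2 → ℤ, 0 < w 0 ∧ 0 < w 1 ∧ ε ∈ Dt.support ∧
        ∀ ε' ∈ Dt.support, ε' ≠ ε → w 0 * (ε 0 : ℤ) + w 1 * (ε 1 : ℤ) < w 0 * (ε' 0 : ℤ) + w 1 * (ε' 1 : ℤ)} := by
    rintro e ⟨w, hw0, hw1, he, hmin⟩
    obtain ⟨ε, hε, rfl⟩ := exists_of_mem_support_aeval ν₁ ν₂ Dt he
    refine ⟨ε, ⟨fun i => if i = 0 then w 0 * (ν₁ 0 : ℤ) + w 1 * (ν₁ 1 : ℤ) else w 0 * (ν₂ 0 : ℤ) + w 1 * (ν₂ 1 : ℤ),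
      by simpa using wt_pos w hw0 hw1 ν₁ hν₁, by simpa using wt_pos w hw0 hw1 ν₂ hν₂, hε, ?_⟩, rfl⟩
    intro ε' hε' hne
    have hmem : θ ε' ∈ (Φ Dt).support := by
      rw [mem_support_iff, hθ]
      simp only
      rw [coeff_aeval_theta ν₁ ν₂ hind]
      exact mem_support_iff.mp hε'
    have hne' : θ ε' ≠ θ ε := fun h => hne (theta_injective ν₁ ν₂ hind h)
    have hlt := hmin (θ ε') hmem hne'
    simp only [hθ, wt_theta] at hlt
    simpa using hlt
  have hfin : {ε : Fin 2 →₀ ℕ | ∃ w : Fin 2 → ℤ, 0 < w 0 ∧ 0 < w 1 ∧ ε ∈ Dt.support ∧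
        ∀ ε' ∈ Dt.support, ε' ≠ ε → w 0 * (ε 0 : ℤ) + w 1 * (ε 1 : ℤ) < w 0 * (ε' 0 : ℤ) + w 1 * (ε' 1 : ℤ)}.Finite :=
    (Finset.finite_toSet _).subset (by rintro ε ⟨w, -, -, hε, -⟩; exact hε)
  rw [hD]
  calc _ ≤ (θ '' {ε : Fin 2 →₀ ℕ | ∃ w : Fin 2 → ℤ, 0 < w 0 ∧ 0 < w 1 ∧ ε ∈ Dt.support ∧
        ∀ ε' ∈ Dt.support, ε' ≠ ε → w 0 * (ε 0 : ℤ) + w 1 * (ε 1 : ℤ) < w 0 * (ε' 0 : ℤ) + w 1 * (ε' 1 : ℤ)}).ncard :=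
        Set.ncard_le_ncard hsub (hfin.image θ)
    _ ≤ _ := Set.ncard_image_le hfin
    _ ≤ 2 ^ (n + 1) := hsep

end Summit.ValiantsHypothesis.ValiantsHypothesis.Theorems.TwoProducts.TwoRayAxial
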